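import Literature.Analysis.FluidPDE.FluidComputer.ThresholdLevelTableU
import HarnessLib

/-!
# Kernel run of the re-cut table over the 10⁻² box, chunks 52 … 55 (bp3 gen 13, layer 4: robustness variant U)

HONEST FRAMING: low prior, high value-of-information experiment on Tao's machine paradigm; NOT a
claim that NS blows up.

Four kernel evaluations (`decide +kernel`; no `native_decide`, no extra axioms) of the checker
`runSteps` (`ThresholdLevelCheck.lean`) with the interval gate data `GIu` (all seven data within
relative `10⁻²`) on ≤ 25 steps of `ThresholdLevelTableU.stepsU` at a time, from `Bu i` towards the next chunk's
first level, returning `Bu (i+1)` (`Bu 0 = ThresholdLevelTable.Bc0`).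
-/

namespace Literature.Analysis.FluidPDE.FluidComputer

namespace ThresholdLevelTableU

open ThresholdLevelTable (Bc0 RbIt)

set_option maxHeartbeats 10000000 in
set_option maxRecDepth 200000 in
/-- Chunk 52 of the re-cut table run over the 10⁻² box (steps 1300 … 1324). [folklore] -/
theorem runU52 : runSteps 60 12 3 GIu RbIt Bu52 chunkU52 47463770695992728 = some Bu53 := by
  decide +kernel

set_option maxHeartbeats 10000000 in
set_option maxRecDepth 200000 in
/-- Chunk 53 of the re-cut table run over the 10⁻² box (steps 1325 … 1349). [folklore] -/
theorem runU53 : runSteps 60 12 3 GIu RbIt Bu53 chunkU53 51780109442802328 = some Bu54 := by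
  decide +kernel

set_option maxHeartbeats 10000000 in
set_option maxRecDepth 200000 in
/-- Chunk 54 of the re-cut table run over the 10⁻² box (steps 1350 … 1374). [folklore] -/
theorem runU54 : runSteps 60 12 3 GIu RbIt Bu54 chunkU54 56489659351087872 = some Bu55 := by
  decide +kernel

set_option maxHeartbeats 10000000 in
set_option maxRecDepth 200000 in
/-- Chunk 55 of the re-cut table run over the 10⁻² box (steps 1375 … 1399). [folklore] -/
theorem runU55 : runSteps 60 12 3 GIu RbIt Bu55 chunkU55 61626809263026112 = some Bu56 := by
  decide +kernel

end ThresholdLevelTableU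

end Literature.Analysis.FluidPDE.FluidComputer
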